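import Summits.Ventures.PercRepro.C026C028Defs
import Summits.Ventures.PercRepro.C026MarkCEdge
import Summits.Ventures.PercRepro.Classical

/-!
# The one-edge recursion of C-028(c) and the mark–`c` step (p6, gen 15; mine-3 MINE3-GLUING v4 §7)

With `q = p e`, the five rows are affine in `q` (`law3_split_edge`), so the C-028 defect obeys
`d(p) = q·d(p[e:=1]) + (1 − q)·d(p[e:=0]) + q(1 − q)·I_A·I_B` (`c028Cov_rec`; `I_A = pivA26`,
`I_B = pivD26`).  At an edge `e` joining the probe `c` to the mark `a`, the minor `p[e:=1]` has `c`
on the mark: the rows `ab|c`, `bc|a`, `a|b|c` vanish there, `d(p[e:=1]) = 0`, `I_B = K₀ = P₀(c mark-free)`,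
`I_A = Y_b(p[e:=0])`, and `Y_a(p) = Y_a(p[e:=0]) + q·Z₀`, `Y_b(p) = (1 − q)·Y_b(p[e:=0])`.  Harris on the
two decreasing events `{c mark-free}`, `{a ↮ b}` gives `Z₀ ≥ K₀·P₀(a ↮ b)`, and the real inequality
`c028_markc_core` closes: **C-028 at `p[e:=0]` implies C-028 at `p`** at every mark–`c` edge
(`C028At_of_edge_ac`, `C028At_of_edge_bc`).  At an `a`–`b` edge `I_B = 0` and `d(p[e:=1]) = 0`, so
C-028 passes from `p[e:=0]` to `p` as well (`C028At_of_edge_ab`).  These are the mark–`c` and `a`–`b`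
steps of mine-3's one-edge induction for C-028 (the loop step is the same bookkeeping with equal minors);
the step at mark–non-mark edges (its (A)) is the open crux of the lane.
-/

namespace PercRepro

/-- **The real core of the mark–`c` step** (mine-3 §7 (2)): from `d ≤ √(Y_a Y_b)` and the Harris bound
`K(Y_a + Y_b + Z) ≤ Z`, `(1 − q)(d + qK·Y_b) ≤ √((Y_a + qZ)·(1 − q)Y_b)` for `0 ≤ q ≤ 1`. -/
theorem c028_markc_core {q d Ya Yb Z K : ℝ} (hq0 : 0 ≤ q) (hq1 : q ≤ 1) (hYa : 0 ≤ Ya) (hYb : 0 ≤ Yb)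
    (hZ : 0 ≤ Z) (hK : 0 ≤ K) (hd : d ≤ Real.sqrt (Ya * Yb)) (hH : K * (Ya + Yb + Z) ≤ Z) :
    (1 - q) * (d + q * K * Yb) ≤ Real.sqrt ((Ya + q * Z) * ((1 - q) * Yb)) := by
  set r := Real.sqrt (Ya * Yb) with hr
  have hr0 : 0 ≤ r := Real.sqrt_nonneg _
  have hr2 : r ^ 2 = Ya * Yb := Real.sq_sqrt (mul_nonneg hYa hYb)
  -- AM–GM: `2r ≤ Ya + Yb`
  have hamgm : 2 * r ≤ Ya + Yb := by
    nlinarith [sq_nonneg (Ya - Yb), sq_nonneg (2 * r - (Ya + Yb))]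
  -- Harris, iterated: `Z ≥ K Ya + K Yb + K² Yb`
  have hZ' : K * Ya + K * Yb + K ^ 2 * Yb ≤ Z := by
    have h1 : K * (K * (Ya + Yb + Z)) ≤ K * Z := mul_le_mul_of_nonneg_left hH hK
    nlinarith [mul_nonneg hK hYa, mul_nonneg hK hZ, mul_nonneg (mul_nonneg hK hK) hYa,
      mul_nonneg (mul_nonneg hK hK) hZ]
  have hT : 0 ≤ Ya + Z - 2 * (1 - q) * K * r - q * (1 - q) * K ^ 2 * Yb := by
    have h1 : 2 * (1 - q) * K * r ≤ K * (Ya + Yb) := by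
      have : 2 * (1 - q) * K * r ≤ 2 * K * r := by nlinarith [mul_nonneg hK hr0]
      nlinarith [mul_le_mul_of_nonneg_left hamgm hK]
    have h2 : q * (1 - q) * K ^ 2 * Yb ≤ K ^ 2 * Yb := by
      have : q * (1 - q) ≤ 1 := by nlinarith
      nlinarith [mul_nonneg (sq_nonneg K) hYb]
    nlinarith
  by_cases hL : (1 - q) * (d + q * K * Yb) ≤ 0
  · exact le_trans hL (Real.sqrt_nonneg _)
  · have hL' : 0 < (1 - q) * (d + q * K * Yb) := lt_of_not_ge hL
    rw [Real.le_sqrt' hL']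
    have h1q : 0 < 1 - q := by
      rcases lt_or_eq_of_le hq1 with h | h
      · linarith
      · exfalso; rw [h] at hL'; simp at hL'
    have hpos : 0 < d + q * K * Yb := by
      by_contra h
      have h' : d + q * K * Yb ≤ 0 := le_of_not_gt h
      nlinarith [mul_nonneg h1q.le (neg_nonneg.2 h')]
    set s := r + q * K * Yb with hs
    have hds : d + q * K * Yb ≤ s := by rw [hs]; linarith
    have hsq : (d + q * K * Yb) ^ 2 ≤ s ^ 2 := by
      have := mul_le_mul hds hds hpos.le (by rw [hs]; positivity)
      nlinarith
    have key : (1 - q) * s ^ 2 ≤ (Ya + q * Z) * Yb := by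
      have e : (Ya + q * Z) * Yb - (1 - q) * s ^ 2 =
          q * Yb * (Ya + Z - 2 * (1 - q) * K * r - q * (1 - q) * K ^ 2 * Yb) +
            (1 - q) * (Ya * Yb - r ^ 2) := by
        rw [hs]; ring
      have : 0 ≤ (Ya + q * Z) * Yb - (1 - q) * s ^ 2 := by
        rw [e, hr2, sub_self, mul_zero, add_zero]
        exact mul_nonneg (mul_nonneg hq0 hYb) hT
      linarith
    calc ((1 - q) * (d + q * K * Yb)) ^ 2 = (1 - q) ^ 2 * (d + q * K * Yb) ^ 2 := by ring
      _ ≤ (1 - q) ^ 2 * s ^ 2 := by gcongr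
      _ = (1 - q) * ((1 - q) * s ^ 2) := by ring
      _ ≤ (1 - q) * ((Ya + q * Z) * Yb) := by gcongr
      _ = (Ya + q * Z) * ((1 - q) * Yb) := by ring

namespace MultiGraph

variable {V E : Type*} (G : MultiGraph V E) [Fintype E] [DecidableEq E]

/-- **The rows are affine in `q = p e`**: `law3 p = q·law3 p[e:=1] + (1 − q)·law3 p[e:=0]`. -/
theorem law3_split_edge (p : E → ℝ) (e : E) (a b c : V) (s : Fin 5) :
    G.law3 p a b c s =
      p e * G.law3 (Function.update p e 1) a b c s +
        (1 - p e) * G.law3 (Function.update p e 0) a b c s :=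
  prob_split p e _

/-- **The one-edge recursion of the C-028 defect** (mine-3 §7 (1)):
`d(p) = q·d(p[e:=1]) + (1 − q)·d(p[e:=0]) + q(1 − q)·I_A·I_B`. -/
theorem c028Cov_rec (p : E → ℝ) (e : E) (a b c : V) :
    G.c028Cov p a b c =
      p e * G.c028Cov (Function.update p e 1) a b c +
        (1 - p e) * G.c028Cov (Function.update p e 0) a b c +
        p e * (1 - p e) * (G.pivA26 p e a b c * G.pivD26 p e a b c) := by
  have h := G.law3_split_edge p e a b c
  rw [G.pivD26_eq_rowsB]
  unfold c028Cov pivA26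
  rw [h 0, h 1, h 2, h 3]
  ring

/-! ### The rows of `p[e:=1]` at an edge joining `c` and `a` -/

omit [Fintype E] in
/-- With an edge joining `c` and `a` forced open, `a ↔ c` surely. -/
theorem lift_true_subset_conn_ac {e : E} {a c : V}
    (he : (G.fst e = a ∧ G.snd e = c) ∨ (G.fst e = c ∧ G.snd e = a)) (ω : Config E) :
    G.Conn (Function.update ω e true) a c := by
  have hopen : Function.update ω e true e = true := by simp
  have hadj := G.openAdj_of_open e hopen
  rcases he with ⟨h1, h2⟩ | ⟨h1, h2⟩
  · rw [h1, h2] at hadj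
    exact Conn.of_openAdj hadj
  · rw [h1, h2] at hadj
    exact (Conn.of_openAdj hadj).symm

/-- An event inside `{a ↮ c}` has probability `0` once an edge joining `c` and `a` is forced open. -/
theorem prob_update_one_eq_zero_of_subset_sep (p : E → ℝ) {e : E} {a c : V}
    (he : (G.fst e = a ∧ G.snd e = c) ∨ (G.fst e = c ∧ G.snd e = a)) {X : Set (Config E)}
    (hX : X ⊆ G.sepEvent a c) : prob (Function.update p e 1) X = 0 := by
  rw [prob_update_one_eq_prob_lift]
  have : lift e true X = ∅ := by
    ext ω
    simp only [mem_lift, Set.mem_empty_iff_false, iff_false]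
    intro h
    exact (G.mem_sepEvent.1 (hX h)) (G.lift_true_subset_conn_ac he ω)
  rw [this, prob_empty]

/-- Row `ab|c` vanishes at `p[e:=1]` for an edge joining `c` and `a`. -/
theorem law3_update_one_one_eq_zero (p : E → ℝ) {e : E} {a c : V}
    (he : (G.fst e = a ∧ G.snd e = c) ∨ (G.fst e = c ∧ G.snd e = a)) (b : V) :
    G.law3 (Function.update p e 1) a b c 1 = 0 := by
  rw [law3_one, G.partitionEvent_row_ab_c]
  exact G.prob_update_one_eq_zero_of_subset_sep p he Set.inter_subset_right

/-- Row `bc|a` vanishes at `p[e:=1]` for an edge joining `c` and `a`. -/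
theorem law3_update_one_three_eq_zero (p : E → ℝ) {e : E} {a c : V}
    (he : (G.fst e = a ∧ G.snd e = c) ∨ (G.fst e = c ∧ G.snd e = a)) (b : V) :
    G.law3 (Function.update p e 1) a b c 3 = 0 := by
  rw [law3_three, G.partitionEvent_row_bc_a]
  refine G.prob_update_one_eq_zero_of_subset_sep p he fun ω hω => ?_
  rw [Set.mem_inter_iff, mem_connEvent, mem_sepEvent] at hω
  rw [mem_sepEvent]
  intro hac
  exact hω.2 (hac.trans hω.1.symm)

/-- Row `a|b|c` vanishes at `p[e:=1]` for an edge joining `c` and `a`. -/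
theorem law3_update_one_four_eq_zero (p : E → ℝ) {e : E} {a c : V}
    (he : (G.fst e = a ∧ G.snd e = c) ∨ (G.fst e = c ∧ G.snd e = a)) (b : V) :
    G.law3 (Function.update p e 1) a b c 4 = 0 := by
  rw [law3_four, G.partitionEvent_row_a_b_c]
  exact G.prob_update_one_eq_zero_of_subset_sep p he
    (Set.inter_subset_left.trans Set.inter_subset_right)

/-- `I_A = Y_b(p[e:=0])` at an edge joining `c` and `a`: the `a`–`b` connection gained by opening the
edge is exactly `{c ↔ b, a ↮ b}` with the edge closed. -/
theorem pivA26_eq_of_edge_ac (p : E → ℝ) {e : E} {a c : V}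
    (he : (G.fst e = a ∧ G.snd e = c) ∨ (G.fst e = c ∧ G.snd e = a)) (b : V) :
    G.pivA26 p e a b c = G.law3 (Function.update p e 0) a b c 3 := by
  rw [pivA26_eq, prob_update_one_eq_prob_lift, G.lift_true_A_eq he b, prob_update_zero_eq_prob_lift,
    law3_three, G.partitionEvent_row_bc_a, prob_update_zero_eq_prob_lift]
  have h1 : lift e false (G.connEvent a b) ∪ lift e false (G.connEvent c b) =
      lift e false (G.connEvent a b ∪ G.connEvent c b) := rfl
  have h2 := prob_diff p (lift e false (G.connEvent a b ∪ G.connEvent c b))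
    (lift e false (G.connEvent a b))
  have h3 : lift e false (G.connEvent a b ∪ G.connEvent c b) ∩ lift e false (G.connEvent a b) =
      lift e false (G.connEvent a b) := by
    ext ω
    simp only [Set.mem_inter_iff, mem_lift, Set.mem_union, mem_connEvent]
    tauto
  have h4 : lift e false (G.connEvent a b ∪ G.connEvent c b) \ lift e false (G.connEvent a b) =
      lift e false (G.connEvent b c ∩ G.sepEvent a b) := by
    ext ω
    simp only [Set.mem_sdiff, mem_lift, Set.mem_union, Set.mem_inter_iff, mem_connEvent, mem_sepEvent]
    constructor
    · rintro ⟨h, hn⟩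
      refine ⟨?_, hn⟩
      rcases h with h | h
      · exact absurd h hn
      · exact h.symm
    · rintro ⟨h, hn⟩
      exact ⟨Or.inr h.symm, hn⟩
  rw [h1]
  rw [h3, h4] at h2
  linarith

/-- `I_B = K₀ = P₀(c mark-free)` at an edge joining `c` and `a`. -/
theorem pivD26_eq_of_edge_ac (p : E → ℝ) {e : E} {a c : V}
    (he : (G.fst e = a ∧ G.snd e = c) ∨ (G.fst e = c ∧ G.snd e = a)) (b : V) :
    G.pivD26 p e a b c =
      G.law3 (Function.update p e 0) a b c 1 + G.law3 (Function.update p e 0) a b c 4 := by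
  unfold pivD26
  rw [G.law3_update_one_one_eq_zero p he b, G.law3_update_one_four_eq_zero p he b]
  ring

/-- The C-028 defect vanishes at `p[e:=1]` for an edge joining `c` and `a` (`c` is on the mark). -/
theorem c028Cov_update_one_eq_zero (p : E → ℝ) {e : E} {a c : V}
    (he : (G.fst e = a ∧ G.snd e = c) ∨ (G.fst e = c ∧ G.snd e = a)) (b : V) :
    G.c028Cov (Function.update p e 1) a b c = 0 := by
  have hsum := law3_sum_eq_one G (Function.update p e 1) a b c
  have h1 := G.law3_update_one_one_eq_zero p he b
  have h3 := G.law3_update_one_three_eq_zero p he b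
  have h4 := G.law3_update_one_four_eq_zero p he b
  unfold c028Cov
  rw [h1, h3]
  rw [h1, h3, h4] at hsum
  have hx : G.law3 (Function.update p e 1) a b c 0 + G.law3 (Function.update p e 1) a b c 2 = 1 := by
    linarith
  linear_combination (-(G.law3 (Function.update p e 1) a b c 0)) * hx

/-- `Y_a(p[e:=1]) = Y_a(p[e:=0]) + Z₀` at an edge joining `c` and `a`. -/
theorem law3_update_one_two_eq (p : E → ℝ) {e : E} {a c : V}
    (he : (G.fst e = a ∧ G.snd e = c) ∨ (G.fst e = c ∧ G.snd e = a)) (b : V) :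
    G.law3 (Function.update p e 1) a b c 2 =
      G.law3 (Function.update p e 0) a b c 2 + G.law3 (Function.update p e 0) a b c 4 := by
  have hA1 := G.law3_two_add_three_add_four (Function.update p e 1) a b c
  have hA0 := G.law3_two_add_three_add_four (Function.update p e 0) a b c
  have hpiv := G.pivA26_eq_of_edge_ac p he b
  rw [pivA26_eq] at hpiv
  have hs1 : prob (Function.update p e 1) (G.sepEvent a b) =
      1 - prob (Function.update p e 1) (G.connEvent a b) := prob_compl _ _
  have hs0 : prob (Function.update p e 0) (G.sepEvent a b) =
      1 - prob (Function.update p e 0) (G.connEvent a b) := prob_compl _ _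
  rw [G.law3_update_one_three_eq_zero p he b, G.law3_update_one_four_eq_zero p he b] at hA1
  linarith

/-! ### Harris: `Z ≥ K · P(a ↮ b)` -/

/-- **Harris on `{c mark-free}` and `{a ↮ b}`** (both decreasing): `K · P(a ↮ b) ≤ Z`, i.e.
`(y₁ + z)(y₂ + y₃ + z) ≤ z`. -/
theorem law3_four_ge_mul {p : E → ℝ} (hp : IsProb p) (a b c : V) :
    (G.law3 p a b c 1 + G.law3 p a b c 4) *
        (G.law3 p a b c 2 + G.law3 p a b c 3 + G.law3 p a b c 4) ≤ G.law3 p a b c 4 := by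
  rw [G.law3_one_add_four, G.law3_two_add_three_add_four, law3_four, G.partitionEvent_row_a_b_c]
  have hlow : IsLowerSet (G.sepEvent a c ∩ G.sepEvent b c) :=
    (G.isLowerSet_sepEvent a c).inter (G.isLowerSet_sepEvent b c)
  have h := harris_lower hp hlow (G.isLowerSet_sepEvent a b)
  have hset : G.sepEvent a c ∩ G.sepEvent b c ∩ G.sepEvent a b =
      G.sepEvent a b ∩ G.sepEvent a c ∩ G.sepEvent b c := by
    rw [Set.inter_comm, ← Set.inter_assoc]
  rw [hset] at h
  exact h

/-! ### The mark–`c` step -/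

/-- **The mark–`c` step** (mine-3 §7 (2)): at an edge joining the probe `c` and the mark `a`, C-028(c)
at `p[e:=0]` implies C-028(c) at `p`, at every weight vector. -/
theorem C028At_of_edge_ac {p : E → ℝ} (hp : IsProb p) {e : E} {a c : V}
    (he : (G.fst e = a ∧ G.snd e = c) ∨ (G.fst e = c ∧ G.snd e = a)) (b : V)
    (h0 : G.C028At (Function.update p e 0) a b c) : G.C028At p a b c := by
  have hp0 : IsProb (Function.update p e 0) := hp.update e ⟨le_rfl, zero_le_one⟩
  have hd : G.c028Cov p a b c =
      (1 - p e) * (G.c028Cov (Function.update p e 0) a b c +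
        p e * (G.law3 (Function.update p e 0) a b c 1 + G.law3 (Function.update p e 0) a b c 4) *
          G.law3 (Function.update p e 0) a b c 3) := by
    rw [G.c028Cov_rec p e a b c, G.c028Cov_update_one_eq_zero p he b, G.pivA26_eq_of_edge_ac p he b,
      G.pivD26_eq_of_edge_ac p he b]
    ring
  have h2 : G.law3 p a b c 2 =
      G.law3 (Function.update p e 0) a b c 2 + p e * G.law3 (Function.update p e 0) a b c 4 := by
    rw [G.law3_split_edge p e a b c 2, G.law3_update_one_two_eq p he b]
    ring
  have h3 : G.law3 p a b c 3 = (1 - p e) * G.law3 (Function.update p e 0) a b c 3 := by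
    rw [G.law3_split_edge p e a b c 3, G.law3_update_one_three_eq_zero p he b]
    ring
  unfold C028At at h0 ⊢
  rw [hd, h2, h3]
  exact c028_markc_core (hp e).1 (hp e).2 (prob_nonneg hp0 _) (prob_nonneg hp0 _)
    (prob_nonneg hp0 _) (add_nonneg (prob_nonneg hp0 _) (prob_nonneg hp0 _)) h0
    (G.law3_four_ge_mul hp0 a b c)

/-! ### The symmetry `a ↔ b`, the `b`–`c` edges, the `a`–`b` edges, loops -/

/-- The C-028 defect is symmetric in the marks `a`, `b`. -/
theorem c028Cov_swap_ab (p : E → ℝ) (a b c : V) : G.c028Cov p a b c = G.c028Cov p b a c := by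
  have hA : G.law3 p a b c 0 + G.law3 p a b c 1 = G.law3 p b a c 0 + G.law3 p b a c 1 := by
    rw [G.law3_zero_add_one, G.law3_zero_add_one, G.connEvent_comm a b]
  have hB : G.law3 p a b c 0 + G.law3 p a b c 2 + G.law3 p a b c 3 =
      G.law3 p b a c 0 + G.law3 p b a c 2 + G.law3 p b a c 3 := by
    rw [G.law3_zero_add_two_add_three, G.law3_zero_add_two_add_three, Set.union_comm]
  have hx : G.law3 p a b c 0 = G.law3 p b a c 0 := by
    rw [law3_zero, law3_zero, G.partitionEvent_row_abc, G.partitionEvent_row_abc]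
    congr 1
    ext ω
    simp only [Set.mem_inter_iff, mem_connEvent]
    constructor
    · rintro ⟨hab, hbc⟩
      exact ⟨hab.symm, hab.trans hbc⟩
    · rintro ⟨hba, hac⟩
      exact ⟨hba.symm, hba.trans hac⟩
  unfold c028Cov
  rw [hA, hB, hx]

/-- Row `ac|b` of `(a, b, c)` is row `bc|a` of `(b, a, c)`. -/
theorem law3_two_swap_ab (p : E → ℝ) (a b c : V) : G.law3 p a b c 2 = G.law3 p b a c 3 := by
  rw [law3_two, law3_three, G.partitionEvent_row_ac_b, G.partitionEvent_row_bc_a]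
  congr 1
  ext ω
  simp only [Set.mem_inter_iff, mem_connEvent, mem_sepEvent]
  constructor
  · rintro ⟨h1, h2⟩; exact ⟨h1, fun h => h2 h.symm⟩
  · rintro ⟨h1, h2⟩; exact ⟨h1, fun h => h2 h.symm⟩

/-- C-028(c) is symmetric in the marks `a`, `b`. -/
theorem C028At_swap_ab (p : E → ℝ) (a b c : V) : G.C028At p a b c ↔ G.C028At p b a c := by
  unfold C028At
  rw [G.c028Cov_swap_ab, G.law3_two_swap_ab p a b c, ← G.law3_two_swap_ab p b a c, mul_comm]

/-- **The mark–`c` step at an edge joining `c` and `b`.** -/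
theorem C028At_of_edge_bc {p : E → ℝ} (hp : IsProb p) {e : E} {b c : V}
    (he : (G.fst e = b ∧ G.snd e = c) ∨ (G.fst e = c ∧ G.snd e = b)) (a : V)
    (h0 : G.C028At (Function.update p e 0) a b c) : G.C028At p a b c :=
  (G.C028At_swap_ab p a b c).2
    (G.C028At_of_edge_ac hp he a ((G.C028At_swap_ab _ a b c).1 h0))

/-- **ROW C-028(c) passes through every mark–`c` edge**: at an edge joining the probe `c` to one of the
marks, C-028(c) at `p[e:=0]` implies C-028(c) at `p`. -/
theorem C028At_of_markC {p : E → ℝ} (hp : IsProb p) {e : E} {a b c : V}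
    (he : ((G.fst e = a ∧ G.snd e = c) ∨ (G.fst e = c ∧ G.snd e = a)) ∨
      ((G.fst e = b ∧ G.snd e = c) ∨ (G.fst e = c ∧ G.snd e = b)))
    (h0 : G.C028At (Function.update p e 0) a b c) : G.C028At p a b c := by
  rcases he with he | he
  · exact G.C028At_of_edge_ac hp he b h0
  · exact G.C028At_of_edge_bc hp he a h0

/-- `I_B = 0` at an edge joining the marks `a`, `b`. -/
theorem pivD26_eq_zero_of_edge_ab (p : E → ℝ) {e : E} {a b : V}
    (he : (G.fst e = a ∧ G.snd e = b) ∨ (G.fst e = b ∧ G.snd e = a)) (c : V) :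
    G.pivD26 p e a b c = 0 := by
  rw [pivD26_eq_rowsB, G.law3_zero_add_two_add_three, G.law3_zero_add_two_add_three,
    prob_update_one_eq_prob_lift, prob_update_zero_eq_prob_lift,
    G.lift_true_B_eq_lift_false_of_edge_ab he c, sub_self]

/-- **The `a`–`b` step** (mine-3 §7 (3)): at an edge joining the marks `a`, `b`, C-028(c) at `p[e:=0]`
implies C-028(c) at `p` (`I_B = 0`, the defect vanishes at `p[e:=1]`, and `Y_a`, `Y_b` scale by `1 − q`). -/
theorem C028At_of_edge_ab {p : E → ℝ} (hp : IsProb p) {e : E} {a b : V}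
    (he : (G.fst e = a ∧ G.snd e = b) ∨ (G.fst e = b ∧ G.snd e = a)) (c : V)
    (h0 : G.C028At (Function.update p e 0) a b c) : G.C028At p a b c := by
  have hp1 : IsProb (Function.update p e 1) := hp.update e ⟨zero_le_one, le_rfl⟩
  have hA : prob (Function.update p e 1) (G.connEvent a b) = 1 := by
    rw [prob_update_one_eq_prob_lift, G.lift_true_A_eq_univ_of_edge_ab he, prob_univ]
  have hsep := G.law3_two_add_three_add_four (Function.update p e 1) a b c
  have hs : prob (Function.update p e 1) (G.sepEvent a b) =
      1 - prob (Function.update p e 1) (G.connEvent a b) := prob_compl _ _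
  have h2n := prob_nonneg hp1 (G.partitionEvent ![a, b, c] ![0, 1, 0])
  have h3n := prob_nonneg hp1 (G.partitionEvent ![a, b, c] ![0, 1, 1])
  have h4n := prob_nonneg hp1 (G.partitionEvent ![a, b, c] ![0, 1, 2])
  rw [← law3_two] at h2n
  rw [← law3_three] at h3n
  rw [← law3_four] at h4n
  have h2 : G.law3 (Function.update p e 1) a b c 2 = 0 := by linarith
  have h3 : G.law3 (Function.update p e 1) a b c 3 = 0 := by linarith
  have hx := G.law3_zero_add_one (Function.update p e 1) a b c
  have hd1 : G.c028Cov (Function.update p e 1) a b c = 0 := by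
    unfold c028Cov
    rw [h2, h3, hx, hA]
    ring
  have hd : G.c028Cov p a b c = (1 - p e) * G.c028Cov (Function.update p e 0) a b c := by
    rw [G.c028Cov_rec p e a b c, hd1, G.pivD26_eq_zero_of_edge_ab p he c]
    ring
  have hY2 : G.law3 p a b c 2 = (1 - p e) * G.law3 (Function.update p e 0) a b c 2 := by
    rw [G.law3_split_edge p e a b c 2, h2]
    ring
  have hY3 : G.law3 p a b c 3 = (1 - p e) * G.law3 (Function.update p e 0) a b c 3 := by
    rw [G.law3_split_edge p e a b c 3, h3]
    ring
  have h1q : 0 ≤ 1 - p e := by linarith [(hp e).2]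
  unfold C028At at h0 ⊢
  rw [hd, hY2, hY3]
  have hsq : Real.sqrt ((1 - p e) * G.law3 (Function.update p e 0) a b c 2 *
      ((1 - p e) * G.law3 (Function.update p e 0) a b c 3)) =
      (1 - p e) * Real.sqrt (G.law3 (Function.update p e 0) a b c 2 *
        G.law3 (Function.update p e 0) a b c 3) := by
    rw [show (1 - p e) * G.law3 (Function.update p e 0) a b c 2 *
        ((1 - p e) * G.law3 (Function.update p e 0) a b c 3) =
        (1 - p e) ^ 2 * (G.law3 (Function.update p e 0) a b c 2 *
          G.law3 (Function.update p e 0) a b c 3) by ring,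
      Real.sqrt_mul (sq_nonneg _), Real.sqrt_sq h1q]
  rw [hsq]
  exact mul_le_mul_of_nonneg_left h0 h1q

end MultiGraph

end PercRepro
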